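import Literature.Barriers.NavierStokesRegularity.NavierStokesInequalityCantorWeakSolution
import Literature.Barriers.NavierStokesRegularity.NavierStokesInequalityCantorArrangementHolds
import HarnessLib

/-!
# Scheffer's nearly one-dimensional singular set (1987): the assembly down to Proposition 16 (fact D′)

Barrier catalogue support file for `NavierStokesRegularity` (D-0021). State of the discharge of
the barrier fact `Literature.Barriers.NavierStokesRegularity.NavierStokesInequalityNearlyOneDimSingularSet`
of `NavierStokesInequalitySingularSolutions` (V. Scheffer, *Nearly one dimensional singularities
of solutions to the Navier–Stokes inequality*, Comm. Math. Phys. 110 (1987), 525–551, Theorem of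
§1; restated as W. S. Ożański, Nonlinearity 33 (2020), Thm. 1.6; proof re-exposed in
W. S. Ożański, arXiv:1709.00602v4, Thm. 14, §6) along its printed proof (Ożański, §6.2: "As in
the proof of Theorem 1, the proof is based on a geometric arrangement … We now show how Theorem
14 follows (given the geometric arrangement)"; Scheffer 1987, p. 551):

* fact A′, the Cantor switching principle (Scheffer 1987, (5.39) with Lemmas 5.9–5.15; Ożański
  §6.2, (6.18) and p. 30) — DISCHARGED, `NSICantorSwitching_holds`
  (`NavierStokesInequalityCantorWeakSolution`), whence
  `navierStokesInequalityNearlyOneDimSingularSet_of_blockExists : NSICantorBlockExists → …`;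
* fact C′, the geometric arrangement for Theorem 14 (Scheffer 1987, §4; Ożański §6.5) —
  DISCHARGED, `NSICantorArrangementExists_holds` (`NavierStokesInequalityCantorArrangementHolds`),
  whence `nsiCantorBlockExists_of_block_of_arrangement : NSICantorBlock_of_arrangement → NSICantorBlockExists`
  (the rescaling (6.13)–(6.17) being proved in `NavierStokesInequalityCantorArrangement`);
* fact D′, the level data of an arrangement (Scheffer 1987, Lemmas 3.2, 5.5; Ożański §6.2
  (6.8)–(6.12) and Proposition 16 with §6.3–§6.4, Thm. 17) — `NSICantorBlock_of_arrangement`,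
  OPEN in the tree.

This file records the resulting implication, so that the discharge of fact D′ closes fact B′
(`NSICantorBlockExists`, by `nsiCantorBlockExists_of_block_of_arrangement`) and the barrier fact
itself in one line each:
`navierStokesInequalityNearlyOneDimSingularSet_of_block_of_arrangement :
NSICantorBlock_of_arrangement → NavierStokesInequalityNearlyOneDimSingularSet`.
Nothing new is asserted; no definitions.

## References

* V. Scheffer, Comm. Math. Phys. 110 (1987), 525–551: §1 (Theorem), §5 ((5.34)–(5.39),
  Lemmas 5.5–5.15) and p. 551. [`Scheffer1987`]
* W. S. Ożański, arXiv:1709.00602v4 (2017/2019): Thm. 14, §6.2 (Prop. 16, (6.13)–(6.18),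
  pp. 28–30), §6.5. [`Ozanski2017NSISingular`]
* W. S. Ożański, Nonlinearity 33 (2020), Thm. 1.6. [`Ozanski2019NSI`]
-/

noncomputable section

namespace Literature.Barriers.NavierStokesRegularity

/-- **Scheffer's 1987 theorem from Proposition 16 alone** (Ożański 2017, §6.2, p. 28: "We now
show how Theorem 14 follows (given the geometric arrangement)", the arrangement being proved,
`NSICantorArrangementExists_holds`, and the switching being proved, `NSICantorSwitching_holds`):
fact D′ `NSICantorBlock_of_arrangement` implies the barrier fact
`NavierStokesInequalityNearlyOneDimSingularSet` (Scheffer 1987 = Ożański 2020, Thm. 1.6), through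
`nsiCantorBlockExists_of_block_of_arrangement` and
`navierStokesInequalityNearlyOneDimSingularSet_of_blockExists`.
[cite: Ozanski2017NSISingular, §6.2 pp. 28–30] [cite: Scheffer1987, p. 551] -/
theorem navierStokesInequalityNearlyOneDimSingularSet_of_block_of_arrangement
    (hD : NSICantorBlock_of_arrangement) : NavierStokesInequalityNearlyOneDimSingularSet :=
  navierStokesInequalityNearlyOneDimSingularSet_of_blockExists
    (nsiCantorBlockExists_of_block_of_arrangement hD)

end Literature.Barriers.NavierStokesRegularity

end
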